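import Mathlib.Geometry.Manifold.Algebra.Structures
import Mathlib.Geometry.Manifold.Algebra.LieGroup
import Literature.Geometry.Lorentzian.KillingFieldCurvatureIdentities
import Literature.Geometry.Lorentzian.Stationary
import Summits.FinalStateConjecture.FinalStateConjecture.Theorems.ZeroEnergyKerrOrBombHawkingExtensionIsKerrLevelSetTangential
import HarnessLib

/-!
# Crux `HawkingExtensionIsKerr` (stmt-FinalStateConjecture-17840), line `SketchIdeator2` —
# collar zeroth law, step E1: the differentiated surface-gravity identity

Helper file of the line lead (c3), programme "collar zeroth law".  Abstract setting of step E: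
a `C^∞` pseudo-Riemannian manifold with a GLOBAL Killing field `K`, a real function `κ̃` (`κf`)
smooth at the point `x` (the candidate surface gravity), and a subset `S` (the horizon) on which
`g(K, K) = 0` and the POINTWISE law `g(∇_v K, K) = -κ̃ g(K, v)` holds near `x`, and which near
`x` contains the level set `{g(K, K) = 0}`.  Step E1 (`star_identity`) differentiates the pointwise law along a
tangent vector `X ∈ ker d(g(K,K))_x` with the tangential-derivative lemma of step C: for every
smooth vector field `Z`,
`g(R(X, K) Z, K) + g(∇_Z K, ∇_X K) + X(κ̃) g(K, Z) + κ̃ g(∇_X K, Z) = 0` at `x`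
(O'Neill 1983, Ch. 9, Ex. 8 for `∇_X ∇_Z K`; Wald 1984, §12.5, the computation behind (12.5.30)).
-/

noncomputable section

set_option linter.dupNamespace false

namespace Summit.FinalStateConjecture.FinalStateConjecture.Theorems.HawkingExtensionIsKerr.SketchIdeator2

open Set Function Filter Bundle FiberBundle Literature.Geometry.Lorentzian
open scoped Manifold ContDiff Topology

section Star

variable {E : Type*} [NormedAddCommGroup E] [NormedSpace ℝ E] [FiniteDimensional ℝ E]
  [CompleteSpace E] {H : Type*} [TopologicalSpace H] {I : ModelWithCorners ℝ E H}
  [I.Boundaryless] {M : Type*} [TopologicalSpace M] [ChartedSpace H M] [IsManifold I ∞ M]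
  {g : PseudoRiemannianMetric I ∞ E (TangentSpace I : M → Type _)} [g.HasLeviCivita]
  {K : Π x : M, TangentSpace I x} {κf : M → ℝ}

/-! ### Regularity -/

omit [I.Boundaryless] in
/-- The section `∇K` of `Hom(TM, TM)` is smooth for a Killing field `K` of a smooth metric. -/
theorem contMDiff_totalCovDeriv_of_isKillingField (hK : g.IsKillingField K) :
    ContMDiff I (I.prod 𝓘(ℝ, E →L[ℝ] E)) ∞ (g.leviCivita.totalCovDeriv K) := by
  have hcov : g.leviCivita.IsLocallyContMDiff ∞ :=
    g.isLocallyContMDiff_leviCivita_holds ⊤ (by exact_mod_cast le_top)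
  have h := (hcov univ isOpen_univ).contMDiff hK.contMDiff.contMDiffOn
  exact fun x ↦ (h x (mem_univ x)).contMDiffAt univ_mem

omit [I.Boundaryless] in
/-- `y ↦ ∇_{Z y} K` is `C^∞` at `x` for a Killing field `K` and a field `Z` smooth at `x`. -/
theorem contMDiffAt_leviCivita_apply_of_isKillingField (hK : g.IsKillingField K)
    {Z : Π y : M, TangentSpace I y} {x : M} (hZ : CMDiffAt ∞ (T% Z) x) :
    CMDiffAt ∞ (T% (fun y ↦ g.leviCivita K y (Z y))) x :=
  (contMDiff_totalCovDeriv_of_isKillingField hK x).clm_bundle_apply hZ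

/-! ### The differentiated identity -/

/-- **Step E1 (`★`).**  Let `K` be a Killing field of the smooth metric `g`, `Y`, `Z` smooth vector
fields, `S ⊆ M`, `x ∈ S`, and suppose: near `x`, the zero set of `f = g(K, K)` lies in `S`; on `S`
near `x`, `f = 0` and the pointwise law `g(∇_v K, K) = -κ̃ g(K, v)` holds (`κ̃ = κf`);
`g(K, Y)(x) ≠ 0`; and `df_x ≠ 0`.  Then for every `X ∈ ker df_x`:
`g(R(X, K) Z, K) + g(∇_Z K, ∇_X K) + X(κ̃) g(K, Z) + κ̃ g(∇_X K, Z) = 0` at `x`.  Proof: the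
function `Φ = g(∇_Z K, K) + κ̃ g(K, Z)` vanishes on the level set `{f = 0}` near `x`, so `dΦ_x`
kills `ker df_x` (step C); expand `dΦ_x(X)` with metric compatibility, O'Neill's Killing identity
`∇_X ∇_Z K - ∇_{∇_X Z} K = R(X, K) Z` (Ch. 9, Ex. 8) and the pointwise law at `x`. -/
theorem star_identity (hK : g.IsKillingField K) {Z : Π y : M, TangentSpace I y} {S : Set M}
    {x : M} (hκ : ContMDiffAt I 𝓘(ℝ, ℝ) ∞ κf x) (hZ : CMDiffAt ∞ (T% Z) x) (hx : x ∈ S)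
    (hlevel : ∀ᶠ y in 𝓝 x, g.val y (K y) (K y) = 0 → y ∈ S)
    (hS : ∀ᶠ y in 𝓝 x, y ∈ S → g.val y (K y) (K y) = 0 ∧
      ∀ v, g.val y (g.leviCivita K y v) (K y) = -(κf y) * g.val y (K y) v)
    (hdf : mvfderiv I (fun y ↦ g.val y (K y) (K y)) x ≠ 0)
    {X : TangentSpace I x} (hX : mvfderiv I (fun y ↦ g.val y (K y) (K y)) x X = 0) :
    g.val x (g.riemann x X (K x) (Z x)) (K x)
      + g.val x (g.leviCivita K x (Z x)) (g.leviCivita K x X)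
      + mvfderiv I (κf) x X * g.val x (K x) (Z x)
      + κf x * g.val x (g.leviCivita K x X) (Z x) = 0 := by
  have hLC : g.IsLeviCivita g.leviCivita := PseudoRiemannianMetric.isLeviCivita_leviCivita_holds
  have h2 : (2 : ℕ∞ω) ≤ ∞ := ENat.LEInfty.out
  -- the pointwise data at `x`
  obtain ⟨hfx, hptx⟩ := hS.self_of_nhds hx
  -- the function `Φ`
  set Φ : M → ℝ := fun y ↦ g.val y (g.leviCivita K y (Z y)) (K y)
    + κf y * g.val y (K y) (Z y) with hΦdef
  have hΦS : ∀ᶠ y in 𝓝 x, y ∈ S → Φ y = 0 := by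
    filter_upwards [hS] with y hy hyS
    obtain ⟨-, hpt⟩ := hy hyS
    simp only [hΦdef, hpt (Z y)]
    ring
  have hΦx : Φ x = 0 := hΦS.self_of_nhds hx
  -- regularity
  have hKx : CMDiffAt ∞ (T% K) x := hK.contMDiff x
  have hA : CMDiffAt ∞ (T% (fun y ↦ g.leviCivita K y (Z y))) x :=
    contMDiffAt_leviCivita_apply_of_isKillingField hK hZ
  have hΦ1 : ContMDiffAt I 𝓘(ℝ, ℝ) ∞ Φ x :=
    (g.contMDiffAt_val_apply le_rfl hA hKx).add
      (hκ.mul (g.contMDiffAt_val_apply le_rfl hKx hZ))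
  have hf1 : ContMDiffAt I 𝓘(ℝ, ℝ) ∞ (fun y ↦ g.val y (K y) (K y)) x :=
    g.contMDiffAt_val_apply le_rfl hKx hKx
  -- step C: `dΦ_x (X) = 0`
  have hzero : ∀ᶠ y in 𝓝 x, g.val y (K y) (K y) = g.val x (K x) (K x) → Φ y = Φ x := by
    filter_upwards [hlevel, hΦS] with y hyl hyΦ hfy
    rw [hfx] at hfy
    rw [hΦx, hyΦ (hyl hfy)]
  have hdΦ : mvfderiv I Φ x X = 0 :=
    mvfderiv_apply_eq_zero_of_levelSet (hf1.of_le ENat.LEInfty.out) (hΦ1.of_le ENat.LEInfty.out)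
      hzero hdf hX
  -- expand `dΦ_x (X)`: extend `X` to a field
  set Xf : Π y : M, TangentSpace I y := FiberBundle.extend E X with hXfdef
  have hXf : MDiffAt (T% Xf) x := mdifferentiableAt_extend ..
  have hXfx : Xf x = X := extend_apply_self E X
  have hKd : MDiffAt (T% K) x := hK.mdifferentiableAt x
  have hZd : MDiffAt (T% Z) x := hZ.mdifferentiableAt (by simp)
  have hAd : MDiffAt (T% (fun y ↦ g.leviCivita K y (Z y))) x := hA.mdifferentiableAt (by simp)
  have hd1 : MDiffAt (fun y ↦ g.val y (g.leviCivita K y (Z y)) (K y)) x :=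
    g.mdifferentiableAt_val_apply hAd hKd
  have hd2 : MDiffAt κf x := hκ.mdifferentiableAt (by simp)
  have hd3 : MDiffAt (fun y ↦ g.val y (K y) (Z y)) x := g.mdifferentiableAt_val_apply hKd hZd
  -- compatibility of `∇` for the two pairings
  have hc1 : mvfderiv I (fun y ↦ g.val y (g.leviCivita K y (Z y)) (K y)) x (Xf x) =
      g.val x (g.leviCivita (fun y ↦ g.leviCivita K y (Z y)) x (Xf x)) (K x)
        + g.val x (g.leviCivita K x (Z x)) (g.leviCivita K x (Xf x)) := hLC.2 hXf hAd hKd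
  have hc3 : mvfderiv I (fun y ↦ g.val y (K y) (Z y)) x (Xf x) =
      g.val x (g.leviCivita K x (Xf x)) (Z x) + g.val x (K x) (g.leviCivita Z x (Xf x)) :=
    hLC.2 hXf hKd hZd
  rw [hXfx] at hc1 hc3
  -- O'Neill Ch. 9 Ex. 8: `∇_X ∇_Z K = R(X, K) Z + ∇_{∇_X Z} K`
  have h8 := hK.leviCivita₂_eq_riemann h2 hZd X
  have h8' : g.leviCivita (fun y ↦ g.leviCivita K y (Z y)) x X =
      g.riemann x X (K x) (Z x) + g.leviCivita K x (g.leviCivita Z x X) := by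
    rw [← h8]; abel
  -- the pointwise law at `x` in the direction `∇_X Z`
  have hpt' := hptx (g.leviCivita Z x X)
  -- assemble
  have hsum : mvfderiv I Φ x X =
      mvfderiv I (fun y ↦ g.val y (g.leviCivita K y (Z y)) (K y)) x X
        + (κf x * mvfderiv I (fun y ↦ g.val y (K y) (Z y)) x X
          + g.val x (K x) (Z x) * mvfderiv I (κf) x X) := by
    have hprod : (fun y ↦ κf y * g.val y (K y) (Z y)) =
        (κf) * (fun y ↦ g.val y (K y) (Z y)) := rfl
    have hΦsum : Φ = (fun y ↦ g.val y (g.leviCivita K y (Z y)) (K y))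
        + (fun y ↦ κf y * g.val y (K y) (Z y)) := rfl
    rw [hΦsum, hprod, mvfderiv_add hd1 (hd2.mul hd3), add_apply, mvfderiv_mul hd2 hd3, add_apply]
    simp only [FunLike.coe_smul, Pi.smul_apply, smul_eq_mul]
  rw [hsum, hc1, hc3, h8', map_add, add_apply, hpt'] at hdΦ
  linarith [hdΦ]


/-- **Step E2: the horizon is totally geodesic where `κ̃ ≠ 0`.**  Under the hypotheses of
`star_identity` and `κ̃(x) ≠ 0`: for all `X, Z ∈ ker df_x`, `g(∇_X K, Z) = 0` — the second
fundamental form `B(X, Z) = g(∇_X K, Z)` of the null hypersurface `{f = 0}` vanishes (Wald 1984,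
§12.5: expansion and shear of the horizon generators vanish; here without field equations).
Proof: antisymmetrise `★` in `(X, Z)` using pair symmetry of `R` and the Killing equation. -/
theorem secondFF_eq_zero (hK : g.IsKillingField K) {S : Set M} {x : M}
    (hκ : ContMDiffAt I 𝓘(ℝ, ℝ) ∞ κf x) (hx : x ∈ S)
    (hlevel : ∀ᶠ y in 𝓝 x, g.val y (K y) (K y) = 0 → y ∈ S)
    (hS : ∀ᶠ y in 𝓝 x, y ∈ S → g.val y (K y) (K y) = 0 ∧
      ∀ v, g.val y (g.leviCivita K y v) (K y) = -(κf y) * g.val y (K y) v)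
    (hdf : mvfderiv I (fun y ↦ g.val y (K y) (K y)) x ≠ 0) (hkx : κf x ≠ 0)
    {X Z : TangentSpace I x} (hX : mvfderiv I (fun y ↦ g.val y (K y) (K y)) x X = 0)
    (hZ : mvfderiv I (fun y ↦ g.val y (K y) (K y)) x Z = 0) :
    g.val x (g.leviCivita K x X) Z = 0 := by
  have hLC : g.IsLeviCivita g.leviCivita := PseudoRiemannianMetric.isLeviCivita_leviCivita_holds
  have h2 : (2 : ℕ∞ω) ≤ ∞ := ENat.LEInfty.out
  obtain ⟨-, hptx⟩ := hS.self_of_nhds hx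
  -- `g(K, X) = g(K, Z) = 0` (from `df_x = -2 κ̃ g(K, ·)` and `κ̃ ≠ 0`)
  have hdfv : ∀ v, mvfderiv I (fun y ↦ g.val y (K y) (K y)) x v = -(2 * κf x) * g.val x (K x) v := by
    intro v
    rw [hK.mvfderiv_val_self_apply x v, hptx v]
    ring
  have hKX : g.val x (K x) X = 0 := by
    have h := hdfv X
    rw [hX] at h
    have : 2 * κf x ≠ 0 := mul_ne_zero two_ne_zero hkx
    exact (mul_eq_zero.mp h.symm).resolve_left (neg_ne_zero.mpr this)
  have hKZ : g.val x (K x) Z = 0 := by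
    have h := hdfv Z
    rw [hZ] at h
    have : 2 * κf x ≠ 0 := mul_ne_zero two_ne_zero hkx
    exact (mul_eq_zero.mp h.symm).resolve_left (neg_ne_zero.mpr this)
  -- `★` twice, on the extended fields
  set Zf : Π y : M, TangentSpace I y := FiberBundle.extend E Z with hZfdef
  set Xf : Π y : M, TangentSpace I y := FiberBundle.extend E X with hXfdef
  have hZf : CMDiffAt ∞ (T% Zf) x := contMDiffAt_extend ..
  have hXf : CMDiffAt ∞ (T% Xf) x := contMDiffAt_extend ..
  have hZfx : Zf x = Z := extend_apply_self E Z
  have hXfx : Xf x = X := extend_apply_self E X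
  have h1 := star_identity hK hκ hZf hx hlevel hS hdf hX
  have h2' := star_identity hK hκ hXf hx hlevel hS hdf hZ
  rw [hZfx] at h1
  rw [hXfx] at h2'
  rw [hKZ, mul_zero, add_zero] at h1
  rw [hKX, mul_zero, add_zero] at h2'
  -- pair symmetry of `R`, symmetry of `g`, Killing equation
  have hR : g.val x (g.riemann x X (K x) Z) (K x) = g.val x (g.riemann x Z (K x) X) (K x) := by
    have := hLC.val_curvature_pair_symm h2 x X (K x) Z (K x)
    exact this
  have hsym : g.val x (g.leviCivita K x Z) (g.leviCivita K x X) =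
      g.val x (g.leviCivita K x X) (g.leviCivita K x Z) := g.symm x _ _
  have hKill := hK.val_leviCivita_add x X Z
  rw [g.symm x X (g.leviCivita K x Z)] at hKill
  have : κf x * (2 * g.val x (g.leviCivita K x X) Z) = 0 := by
    linear_combination h1 - h2' - hR - hsym + (κf x) * hKill
  have h3 := (mul_eq_zero.mp this).resolve_left hkx
  linarith

end Star


/-- **Registered sub-goal form of step E2** (closed statement over `E4`-charted manifolds, crux
stmt-FinalStateConjecture-17840): the horizon is totally geodesic where `κ̃ ≠ 0`. -/
theorem stub_secondFF_eq_zero : ∀ (M : Type) [TopologicalSpace M] [ChartedSpace E4 M] [IsManifold (𝓡 4) ∞ M] (g : PseudoRiemannianMetric (𝓡 4) ∞ E4 (TangentSpace (𝓡 4) : M → Type _)) [g.HasLeviCivita] (K : Π x : M, TangentSpace (𝓡 4) x) (κf : M → ℝ) (S : Set M) (x : M), g.IsKillingField K → ContMDiffAt (𝓡 4) 𝓘(ℝ, ℝ) ∞ κf x → x ∈ S → (∀ᶠ y in 𝓝 x, g.val y (K y) (K y) = 0 → y ∈ S) → (∀ᶠ y in 𝓝 x, y ∈ S → g.val y (K y)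 (K y) = 0 ∧ ∀ v, g.val y (g.leviCivita K y v) (K y) = -(κf y) * g.val y (K y) v) → mvfderiv (𝓡 4) (fun y ↦ g.val y (K y) (K y)) x ≠ 0 → κf x ≠ 0 → ∀ X Z : TangentSpace (𝓡 4) x, mvfderiv (𝓡 4) (fun y ↦ g.val y (K y) (K y)) x X = 0 → mvfderiv (𝓡 4) (fun y ↦ g.val y (K y) (K y)) x Z = 0 → g.val x (g.leviCivita K x X) Z = 0 :=
  fun _ _ _ _ _ _ _ _ _ _ hK hκ hx hlevel hS hdf hkx _ _ hX hZ ↦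
    secondFF_eq_zero hK hκ hx hlevel hS hdf hkx hX hZ

end Summit.FinalStateConjecture.FinalStateConjecture.Theorems.HawkingExtensionIsKerr.SketchIdeator2

end
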